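import Literature.Probability.FitznerVanDerHofstad2017.NobleNSums
import HarnessLib

/-!
# [FvdH17] Prop. 5.5–5.6 weighted rows summed over `N`: the `N`-slices of the cell-41/42 series and the `NSumLE` glue — PROVED in abstract form

Source: R. Fitzner, R. van der Hofstad, *Mean-field behavior for nearest-neighbor percolation in `d > 10`*,
Electron. J. Probab. **22** (2017) no. 43 [FvdH17]; equation / page numbers of arXiv:1506.07977v2.
Proposition 5.5 (5.35)–(5.36) and Proposition 5.6 (5.38)–(5.41) (v2 p. 53) bound the WEIGHTED coefficients for one
`N ≥ 2` by sums over the position of the weighted block, e.g. (5.35), `N` even: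
"`Σ_x ‖x‖₂² Ξ^{(N)}_p(x) ≤ (N+2)[h⃗^S (A^ι)^T (B̄^ι)^{N−1} P⃗^E + P⃗^S (B^ι)^{N−1}(H^{(3)} P⃗^E + A^ι h⃗^E)]`
`+ (N+2) Σ_{M=0}^{N/2−1} P⃗^S (B^ι)^{2M} (C^{(1)} B̄^ι + 1_{M ≠ N/2−1} B^ι C^{(2)}) (B̄^ι)^{N−3−2M} P⃗^E`",
and Remark 2.3 (pp. 12–13): "For our analysis we require a bound on this when summed over `N` … The sum of this
over `N` is computed using the geometric sum".  The notebook `Percolation.nb` [FvdHnb] cell 42 (transcript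
HOME/b2b-lace-num3/published/Percolation.txt l.1161–1170) records the `N`-sums of fixed parity as the symbols typed in
`Stage1Tails` (tables `Tail.xiEvenDelta`, `Tail.xiOddDelta`, `Tail.xiIotaEvenDeltaEi`, `Tail.xiIotaOddDeltaEi`,
`Tail.xiIotaEvenDeltaZero`, `Tail.xiIotaOddDeltaZero`; each piece `c · Σ_{(a,b)} ψ(a)χ(b) · uᵀ B^α (B²)^a M (B̄²)^b B̄^β w`
= `c · Stage1Tails.ser drop ψ χ …`, the `(0,0)` term subtracted when `drop`).  The target shape is [NoBLE17]
Assumption 4.3 (4.32)–(4.33) as typed in `NobleAssumptions` (`NSumLE`: "`Σ_N Σ_x ‖x‖₂² Ξ^{(N)}(x) ≤ β^{abs}_{ΔΞ}`",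
R. Fitzner, R. van der Hofstad, PTRF **169** (2017), Assumption 4.3, p. 1086).

What this module proves (kernel-checked; nothing cited as a hypothesis; no dimension, no numeral of the notebooks;
abstract over a finite index type `n` and abstract ingredients `Stage1Tails.Ingr n`):
* `hasSum_sum_antidiagonal` — a summable `ℕ × ℕ`-family regrouped along antidiagonals `a + b = k` [folklore];
* `slice ψ χ u B α M B̄ β w k = Σ_{a+b=k} ψ(a)χ(b) · uᵀ B^α (B²)^a M (B̄²)^b B̄^β w` — the `N`-SLICE of the double
  series (⋆) of `Stage1Tails` (all terms with the same number `α + β + 2k (+1)` of blocks, i.e. the same `N`), with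
  `slice_eq_sum_range` (the print's index `M = a`), `slice_zero`, the one-sided cases `slice_kDelta_left/right`;
* `hasSum_slice` — `Σ_k slice k = ser false …`; `ser_true_eq`, `hasSum_slice_succ` — for a DROPPED pair the `(0,0)`
  term is the explicit `N = 2, 3` cell of the notebook (`Bound[·,2,Delta,·]`, `Bound[·,3,Delta,·]`), so the dropped
  series is the sum of the slices `k ≥ 1`: `Σ_j slice (j+1) = ser true …`;
* `pieceSlice`, `totalSlice I l j` — the `j`-th slice of a whole table (dropped pieces read one slice later) and
  `hasSum_totalSlice : Σ_j totalSlice I l j = total Reading.series I l` under entrywise non-negative ingredients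
  and the two Neumann certificates `(1 − B²)S = 1`, `(1 − B̄²)S̄ = 1`, `0 ≤ S, S̄` (convergence from `Stage1Tails.ser_le`);
* THE GLUE `NSumLE_of_sliceBounds` / `NSumLE_closed_of_sliceBounds` / `NSumLE_tail_of_sliceBounds`: per-`j` bounds
  `Σ'_x G_j(x) ≤ totalSlice I l j` (the per-`N` displays (5.35)–(5.41) along `N = n₀ + 2j`, rearranged into the
  table's slices) give `NSumLE G (total Reading.series I l)` and `≤ total (Reading.closed S S̄) I l`
  (`Stage1Tails.total_mono`, `Reading.series_leAt_closed`) — i.e. exactly the `tailVal` summands of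
  `Stage1Tails.inpFull` / `inpMaj` for the weighted rows; `NSumLE_weightedRows_of_sliceBounds` assembles the four
  rows `EvenTail-Δ`, `OddTail-Δ`, `Even-Δ`, `Odd-Δ` of one family from the cells `N ≤ 3` and the two tables.
NOT here: the per-`N` diagrammatic bounds themselves (Prop. 5.5/5.6, [Fit13] Ch. 4), and the expansion of each
table's slice in the print's coordinates (separate module).

## References
* [FvdH17] arXiv:1506.07977v2: Prop. 5.5 (5.35)–(5.36), Prop. 5.6 (5.38)–(5.41) (p. 53); Remark 2.3 (pp. 12–13).
* [NoBLE17] PTRF 169 (2017): Assumption 4.3 (4.32)–(4.33) (p. 1086).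
* [FvdHnb] `Percolation.nb` cell 42 (transcript l.1161–1170), cells 43–44 (l.1183–1237).
-/

noncomputable section

namespace Literature.Probability.FitznerVanDerHofstad2017.NobleNSums

open Finset
open Literature.Probability.LatticeModels Literature.Probability.Percolation
open Literature.Probability.FitznerVanDerHofstad2017 Stage1Tails EigenTails
open scoped BigOperators Matrix

/-! ## Antidiagonal regrouping of an `ℕ × ℕ`-series -/

section Antidiagonal

/-- A summable `ℕ × ℕ`-family summed along antidiagonals: `Σ_k Σ_{a+b=k} f(a,b) = Σ_{(a,b)} f(a,b)`. [folklore] -/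
theorem hasSum_sum_antidiagonal {f : ℕ × ℕ → ℝ} {s : ℝ} (hf : HasSum f s) :
    HasSum (fun k => ∑ p ∈ antidiagonal k, f p) s := by
  have hsig : HasSum (f ∘ (HasAntidiagonal.sigmaAntidiagonalEquivProd (A := ℕ))) s :=
    (Equiv.hasSum_iff _).2 hf
  refine hsig.sigma fun k => ?_
  have hfin := hasSum_fintype (fun q : (antidiagonal k : Finset (ℕ × ℕ)) =>
    (f ∘ (HasAntidiagonal.sigmaAntidiagonalEquivProd (A := ℕ))) ⟨k, q⟩)
  have hval : ∑ q : (antidiagonal k : Finset (ℕ × ℕ)),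
      (f ∘ (HasAntidiagonal.sigmaAntidiagonalEquivProd (A := ℕ))) ⟨k, q⟩ = ∑ p ∈ antidiagonal k, f p := by
    simp only [Function.comp_apply, HasAntidiagonal.sigmaAntidiagonalEquivProd, Equiv.coe_fn_mk]
    exact Finset.sum_coe_sort (antidiagonal k) f
  rw [hval] at hfin
  exact hfin

/-- … summable version. [folklore] -/
theorem summable_sum_antidiagonal {f : ℕ × ℕ → ℝ} (hf : Summable f) :
    Summable (fun k => ∑ p ∈ antidiagonal k, f p) :=
  (hasSum_sum_antidiagonal hf.hasSum).summable

/-- … `tsum` version. [folklore] -/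
theorem tsum_sum_antidiagonal {f : ℕ × ℕ → ℝ} (hf : Summable f) :
    ∑' k, ∑ p ∈ antidiagonal k, f p = ∑' p, f p :=
  (hasSum_sum_antidiagonal hf.hasSum).tsum_eq

end Antidiagonal

/-! ## The `N`-slices of the series (⋆) -/

section Slices

variable {n : Type*} [Fintype n] [DecidableEq n]

/-- The `k`-th SLICE of the double series (⋆) of `Stage1Tails`: `Σ_{a+b=k} ψ(a) χ(b) · uᵀ B^α (B²)^a M (B̄²)^b B̄^β w`
— all terms with the same total number of blocks (one value of `N`).
[cite: FitznerVanDerHofstad2017, Prop. 5.5 (5.35)–(5.36), Prop. 5.6 (5.38)–(5.41) (arXiv:1506.07977v2 p. 53); notebook Percolation.nb cell 42 (transcript l.1161–1170)] -/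
def slice (ψ χ : ℕ → ℝ) (u : n → ℝ) (B : Matrix n n ℝ) (α : ℕ) (M : Matrix n n ℝ) (Bb : Matrix n n ℝ)
    (β : ℕ) (w : n → ℝ) (k : ℕ) : ℝ :=
  ∑ p ∈ antidiagonal k, ψ p.1 * χ p.2 * term u B α M Bb β w p

/-- The slice in the print's coordinates: index `M = a ∈ {0, …, k}`, `b = k − a`
("`Σ_{M=0}^{…} P⃗ (B)^{2M} C (B̄)^{…−2M} P⃗`"). [cite: FitznerVanDerHofstad2017, Prop. 5.5 (5.35)–(5.36) (arXiv:1506.07977v2 p. 53)] -/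
theorem slice_eq_sum_range (ψ χ : ℕ → ℝ) (u : n → ℝ) (B : Matrix n n ℝ) (α : ℕ) (M : Matrix n n ℝ)
    (Bb : Matrix n n ℝ) (β : ℕ) (w : n → ℝ) (k : ℕ) :
    slice ψ χ u B α M Bb β w k = ∑ a ∈ range (k + 1),
      ψ a * χ (k - a) * (u ⬝ᵥ ((B ^ α * (B * B) ^ a * M * (Bb * Bb) ^ (k - a) * Bb ^ β) *ᵥ w)) := by
  rw [slice, Nat.sum_antidiagonal_eq_sum_range_succ_mk]
  rfl

/-- slice `0` is the single term `ψ(0)χ(0) · uᵀ B^α M B̄^β w`. [folklore] -/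
theorem slice_zero (ψ χ : ℕ → ℝ) (u : n → ℝ) (B : Matrix n n ℝ) (α : ℕ) (M : Matrix n n ℝ)
    (Bb : Matrix n n ℝ) (β : ℕ) (w : n → ℝ) : slice ψ χ u B α M Bb β w 0 = ψ 0 * χ 0 * (u ⬝ᵥ ((B ^ α * M * Bb ^ β) *ᵥ w)) := by
  simp [slice, term]

/-- slices are `≥ 0` for non-negative kinds and ingredients. [folklore] -/
theorem slice_nonneg {ψ χ : ℕ → ℝ} {u : n → ℝ} {B M Bb : Matrix n n ℝ} {w : n → ℝ}
    (hψ : ∀ a, 0 ≤ ψ a) (hχ : ∀ b, 0 ≤ χ b) (h : NN u B M Bb w) (α β k : ℕ) :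
    0 ≤ slice ψ χ u B α M Bb β w k :=
  Finset.sum_nonneg fun p _ => by
    rw [← coef_false]; exact mul_term_nonneg h (coef_nonneg hψ hχ p) α β p

/-- **antidiagonal summation of (⋆), undropped**: `Σ_k slice k = ser false ψ χ …` whenever the double series
converges. [folklore] -/
theorem hasSum_slice {ψ χ : ℕ → ℝ} {u : n → ℝ} {B : Matrix n n ℝ} {α : ℕ} {M : Matrix n n ℝ}
    {Bb : Matrix n n ℝ} {β : ℕ} {w : n → ℝ} 
    (hs : Summable fun p => coef false ψ χ p * term u B α M Bb β w p) :
    HasSum (slice ψ χ u B α M Bb β w) (ser false ψ χ u B α M Bb β w) := by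
  have h := hasSum_sum_antidiagonal hs.hasSum
  have e : slice ψ χ u B α M Bb β w
      = fun k => ∑ p ∈ antidiagonal k, coef false ψ χ p * term u B α M Bb β w p := by
    funext k; simp only [slice, coef_false]
  rw [e]; exact h

/-- the dropped series is the undropped one minus its `(0,0)` term. [folklore] -/
theorem ser_true_eq {ψ χ : ℕ → ℝ} {u : n → ℝ} {B : Matrix n n ℝ} {α : ℕ} {M : Matrix n n ℝ}
    {Bb : Matrix n n ℝ} {β : ℕ} {w : n → ℝ} 
    (hs : Summable fun p => coef false ψ χ p * term u B α M Bb β w p) :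
    ser true ψ χ u B α M Bb β w
      = ser false ψ χ u B α M Bb β w - ψ 0 * χ 0 * (u ⬝ᵥ ((B ^ α * M * Bb ^ β) *ᵥ w)) := by
  unfold ser
  rw [hs.tsum_eq_add_tsum_ite (0, 0)]
  have e : ∀ p : ℕ × ℕ, (if p = (0, 0) then 0 else coef false ψ χ p * term u B α M Bb β w p)
      = coef true ψ χ p * term u B α M Bb β w p := by
    intro p
    by_cases hp : p = (0, 0)
    · subst hp; simp [coef_true_zero]
    · rw [if_neg hp, coef_false, coef_of_ne ψ χ hp]
  have ht0 : term u B α M Bb β w (0, 0) = u ⬝ᵥ ((B ^ α * M * Bb ^ β) *ᵥ w) := by simp [term]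
  rw [tsum_congr e, coef_false, ht0]
  ring

/-- **antidiagonal summation of (⋆), dropped**: the slices `k ≥ 1` sum to `ser true ψ χ …` (the `(0,0)` term
`= slice 0` being the explicit `N = 2, 3` cell `Bound[·,2,Delta,·]` / `Bound[·,3,Delta,·]` of the notebook).
[cite: FitznerVanDerHofstad2017, notebook Percolation.nb cell 42 (transcript l.1161–1170)] -/
theorem hasSum_slice_succ {ψ χ : ℕ → ℝ} {u : n → ℝ} {B : Matrix n n ℝ} {α : ℕ} {M : Matrix n n ℝ}
    {Bb : Matrix n n ℝ} {β : ℕ} {w : n → ℝ} 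
    (hs : Summable fun p => coef false ψ χ p * term u B α M Bb β w p) :
    HasSum (fun k => slice ψ χ u B α M Bb β w (k + 1)) (ser true ψ χ u B α M Bb β w) := by
  rw [ser_true_eq hs, ← slice_zero ψ χ u B α M Bb β w,
    ← Finset.sum_range_one (fun i => slice ψ χ u B α M Bb β w i)]
  exact (hasSum_nat_add_iff' 1).2 (hasSum_slice hs)

/-- one-sided slice, no geometric sum on the left (`ψ = [a = 0]`): `χ(k) · uᵀ B^α M (B̄²)^k B̄^β w`. [folklore] -/
theorem slice_kDelta_left (χ : ℕ → ℝ) (u : n → ℝ) (B : Matrix n n ℝ) (α : ℕ) (M : Matrix n n ℝ)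
    (Bb : Matrix n n ℝ) (β : ℕ) (w : n → ℝ) (k : ℕ) :
    slice kDelta χ u B α M Bb β w k = χ k * (u ⬝ᵥ ((B ^ α * M * (Bb * Bb) ^ k * Bb ^ β) *ᵥ w)) := by
  rw [slice_eq_sum_range, Finset.sum_eq_single 0]
  · simp [kDelta]
  · intro a _ ha; simp [kDelta, ha]
  · intro h; exact absurd (Finset.mem_range.2 (Nat.succ_pos k)) h

/-- one-sided slice, no geometric sum on the right (`χ = [b = 0]`): `ψ(k) · uᵀ B^α (B²)^k M B̄^β w`. [folklore] -/
theorem slice_kDelta_right (ψ : ℕ → ℝ) (u : n → ℝ) (B : Matrix n n ℝ) (α : ℕ) (M : Matrix n n ℝ)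
    (Bb : Matrix n n ℝ) (β : ℕ) (w : n → ℝ) (k : ℕ) :
    slice ψ kDelta u B α M Bb β w k = ψ k * (u ⬝ᵥ ((B ^ α * (B * B) ^ k * M * Bb ^ β) *ᵥ w)) := by
  rw [slice_eq_sum_range, Finset.sum_eq_single k]
  · simp [kDelta]
  · intro a ha hak
    have : k - a ≠ 0 := by
      have := Finset.mem_range.1 ha; omega
    simp [kDelta, this]
  · intro h; exact absurd (Finset.self_mem_range_succ k) h

end Slices

/-! ## Slices of a table of pieces -/

section Tables

variable {n : Type*} [Fintype n] [DecidableEq n]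

/-- by how many slices a piece is read later: `1` for a dropped pair (its `(0,0)` term is the explicit cell), else `0`.
[cite: FitznerVanDerHofstad2017, notebook Percolation.nb cell 42 (transcript l.1161–1170)] -/
def shiftOf (π : Piece) : ℕ := if π.drop then 1 else 0

/-- the `j`-th slice of one piece: `c · slice_{ψ,χ}(j + shift)` (`pieceSlice`). [cite: FitznerVanDerHofstad2017, notebook Percolation.nb cell 42 (transcript l.1161–1170)] -/
def pieceSlice (I : Ingr n) (π : Piece) (j : ℕ) : ℝ :=
  (π.c : ℝ) * slice π.ψ.c π.χ.c (I.u π.u) I.B π.α (I.m π.M) I.Bb π.β (I.w π.w) (j + shiftOf π)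

/-- the `j`-th slice of a table of pieces. [cite: FitznerVanDerHofstad2017, notebook Percolation.nb cell 42 (transcript l.1161–1170)] -/
def totalSlice (I : Ingr n) (l : List Piece) (j : ℕ) : ℝ := (l.map fun π => pieceSlice I π j).sum

/-- empty table. [folklore] -/
@[simp] theorem totalSlice_nil (I : Ingr n) (j : ℕ) : totalSlice I [] j = 0 := by simp [totalSlice]

/-- table with a head piece. [folklore] -/
@[simp] theorem totalSlice_cons (I : Ingr n) (π : Piece) (l : List Piece) (j : ℕ) :
    totalSlice I (π :: l) j = pieceSlice I π j + totalSlice I l j := by simp [totalSlice]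

/-- a piece's slices are `≥ 0` on non-negative ingredients. [folklore] -/
theorem pieceSlice_nonneg {I : Ingr n} (hI : I.Nonneg) (π : Piece) (j : ℕ) : 0 ≤ pieceSlice I π j :=
  mul_nonneg (Nat.cast_nonneg _) (slice_nonneg π.ψ.c_nonneg π.χ.c_nonneg (hI.nn _ _ _) _ _ _)

/-- a table's slices are `≥ 0` on non-negative ingredients. [folklore] -/
theorem totalSlice_nonneg {I : Ingr n} (hI : I.Nonneg) : ∀ (l : List Piece) (j : ℕ), 0 ≤ totalSlice I l j
  | [], j => by simp
  | π :: l, j => by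
    rw [totalSlice_cons]; exact add_nonneg (pieceSlice_nonneg hI π j) (totalSlice_nonneg hI l j)

/-- Under non-negative ingredients and the two Neumann certificates the undropped double series of every piece
converges (`Stage1Tails.ser_le` with `Kind.cert`). [folklore] -/
theorem summable_coef_term {I : Ingr n} (hI : I.Nonneg) {S Sb : Matrix n n ℝ} (hS0 : ∀ i j, 0 ≤ S i j)
    (hS : (1 - I.B * I.B) * S = 1) (hSb0 : ∀ i j, 0 ≤ Sb i j) (hSb : (1 - I.Bb * I.Bb) * Sb = 1)
    (ψ χ : Kind) (a : USym) (α : ℕ) (b : MSym) (β : ℕ) (c : WSym) :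
    Summable fun p => coef false ψ.c χ.c p * term (I.u a) I.B α (I.m b) I.Bb β (I.w c) p :=
  (ser_le ψ.c_nonneg χ.c_nonneg (hI.nn a b c) (Kind.cert (mul_apply_nonneg hI.B hI.B) hS0 hS ψ)
    (Kind.cert (mul_apply_nonneg hI.Bb hI.Bb) hSb0 hSb χ) α β).1

/-- **the slices of a piece sum to its series value** (dropped pieces: slices `≥ 1` sum to the dropped series).
[cite: FitznerVanDerHofstad2017, notebook Percolation.nb cell 42 (transcript l.1161–1170); Remark 2.3 (arXiv:1506.07977v2 pp. 12–13)] -/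
theorem hasSum_pieceSlice {I : Ingr n} (hI : I.Nonneg) {S Sb : Matrix n n ℝ} (hS0 : ∀ i j, 0 ≤ S i j)
    (hS : (1 - I.B * I.B) * S = 1) (hSb0 : ∀ i j, 0 ≤ Sb i j) (hSb : (1 - I.Bb * I.Bb) * Sb = 1) (π : Piece) :
    HasSum (pieceSlice I π) (π.val Reading.series I) := by
  obtain ⟨c, drop, ψ, χ, a, α, b, β, e⟩ := π
  have hs := summable_coef_term hI hS0 hS hSb0 hSb ψ χ a α b β e
  unfold pieceSlice Piece.val Reading.series shiftOf
  cases drop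
  · simp only [Bool.false_eq_true, if_false, add_zero]
    exact (hasSum_slice hs).mul_left _
  · simp only [if_true]
    exact (hasSum_slice_succ hs).mul_left _

/-- **the slices of a table sum to its total in the series reading.** [cite: FitznerVanDerHofstad2017, notebook Percolation.nb cell 42 (transcript l.1161–1170); Remark 2.3 (arXiv:1506.07977v2 pp. 12–13)] -/
theorem hasSum_totalSlice {I : Ingr n} (hI : I.Nonneg) {S Sb : Matrix n n ℝ} (hS0 : ∀ i j, 0 ≤ S i j)
    (hS : (1 - I.B * I.B) * S = 1) (hSb0 : ∀ i j, 0 ≤ Sb i j) (hSb : (1 - I.Bb * I.Bb) * Sb = 1) :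
    ∀ l : List Piece, HasSum (totalSlice I l) (total Reading.series I l)
  | [] => by
    have e : totalSlice I [] = fun _ => 0 := funext fun j => totalSlice_nil I j
    rw [e, total_nil]; exact hasSum_zero
  | π :: l => by
    have e : totalSlice I (π :: l) = fun j => pieceSlice I π j + totalSlice I l j :=
      funext fun j => totalSlice_cons I π l j
    rw [e, total_cons]
    exact (hasSum_pieceSlice hI hS0 hS hSb0 hSb π).add (hasSum_totalSlice hI hS0 hS hSb0 hSb l)

/-- `tsum` form. [folklore] -/
theorem tsum_totalSlice {I : Ingr n} (hI : I.Nonneg) {S Sb : Matrix n n ℝ} (hS0 : ∀ i j, 0 ≤ S i j)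
    (hS : (1 - I.B * I.B) * S = 1) (hSb0 : ∀ i j, 0 ≤ Sb i j) (hSb : (1 - I.Bb * I.Bb) * Sb = 1)
    (l : List Piece) : Summable (totalSlice I l) ∧ ∑' j, totalSlice I l j = total Reading.series I l :=
  ⟨(hasSum_totalSlice hI hS0 hS hSb0 hSb l).summable, (hasSum_totalSlice hI hS0 hS hSb0 hSb l).tsum_eq⟩

end Tables

/-! ## The glue: per-`N` weighted bounds ⇒ `NSumLE` with a cell-42 table as the bound -/

section Glue

variable {d : ℕ} {n : Type*} [Fintype n] [DecidableEq n]

/-- **Prop. 5.5/5.6 weighted rows summed over `N` of fixed parity, typed.**  Let `G_j ≥ 0` (`G_j(x) = ‖x‖₂² Ξ^{(2j+4)}(x)`,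
…) obey per-`j` bounds by the `j`-th slice of a cell-42 table `l` over ingredients `I` (the display (5.35)–(5.41) at
`N = n₀ + 2j`, regrouped), the ingredients be entrywise `≥ 0` and `S`, `S̄` be non-negative two-sided Neumann
certificates of `1 − B²`, `1 − B̄²`.  Then `Σ_j Σ_x G_j(x)` converges and is at most the table's value in the SERIES
reading (`Stage1Tails.total Reading.series I l`, the symbol of cell 42 with eigenvectors eliminated).
[cite: FitznerVanDerHofstad2017, Prop. 5.5 (5.35)–(5.36), Prop. 5.6 (5.38)–(5.41) (arXiv:1506.07977v2 p. 53); Remark 2.3 (pp. 12–13); notebook Percolation.nb cell 42 (transcript l.1161–1170)] -/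
theorem NSumLE_of_sliceBounds {G : ℕ → Site d → ℝ} (h0 : ∀ j x, 0 ≤ G j x) {I : Ingr n} (hI : I.Nonneg)
    {S Sb : Matrix n n ℝ} (hS0 : ∀ i j, 0 ≤ S i j) (hS : (1 - I.B * I.B) * S = 1) (hSb0 : ∀ i j, 0 ≤ Sb i j)
    (hSb : (1 - I.Bb * I.Bb) * Sb = 1) (l : List Piece)
    (hG : ∀ j, Summable (G j) ∧ ∑' x, G j x ≤ totalSlice I l j) : NSumLE G (total Reading.series I l) := by
  obtain ⟨hsum, htsum⟩ := tsum_totalSlice hI hS0 hS hSb0 hSb l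
  rw [← htsum]
  exact NSumLE_of_perN h0 hG hsum

/-- … with the CLOSED-FORM reading `total (Reading.closed S S̄) I l` (the majorant record `Stage1Tails.inpMaj`) as the
bound. [cite: FitznerVanDerHofstad2017, Remark 2.3 (arXiv:1506.07977v2 pp. 12–13); notebook Percolation.nb cell 42 (transcript l.1161–1170)] -/
theorem NSumLE_closed_of_sliceBounds {G : ℕ → Site d → ℝ} (h0 : ∀ j x, 0 ≤ G j x) {I : Ingr n} (hI : I.Nonneg)
    {S Sb : Matrix n n ℝ} (hS0 : ∀ i j, 0 ≤ S i j) (hS : (1 - I.B * I.B) * S = 1) (hSb0 : ∀ i j, 0 ≤ Sb i j)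
    (hSb : (1 - I.Bb * I.Bb) * Sb = 1) (l : List Piece)
    (hG : ∀ j, Summable (G j) ∧ ∑' x, G j x ≤ totalSlice I l j) :
    NSumLE G (total (Reading.closed S Sb) I l) := by
  obtain ⟨h1, h2, h3⟩ := NSumLE_of_sliceBounds h0 hI hS0 hS hSb0 hSb l hG
  exact ⟨h1, h2, h3.trans (total_mono (Reading.series_leAt_closed hI.B hI.Bb hS0 hS hSb0 hSb) hI l)⟩

/-- **The weighted `…Tail` fields** (`F_j`, `j ≥ 0`; e.g. `F_j(x) = ‖x‖₂² Ξ^{(2j+2)}(x)` for `xiEvenTailDelta`): an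
explicit bound `Σ_x F_0 ≤ c` on the first cell (`Bound[Xi,2,Delta,s]`) and slice bounds on the rest give
`NSumLE F (c + total Reading.series I l)` — cell 42 "`Bound[Xi,EvenTail,Delta,s] = Bound[Xi,2,Delta,s] + …`".
[cite: FitznerVanDerHofstad2017, notebook Percolation.nb cell 42 (transcript l.1161–1170); Prop. 5.5 (5.35)–(5.36), Prop. 5.6 (5.38)–(5.41) (arXiv:1506.07977v2 p. 53)] -/
theorem NSumLE_tail_of_sliceBounds {F : ℕ → Site d → ℝ} (h0 : ∀ k x, 0 ≤ F k x) {c : ℝ} (hc : SumLE (F 0) c)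
    {I : Ingr n} (hI : I.Nonneg) {S Sb : Matrix n n ℝ} (hS0 : ∀ i j, 0 ≤ S i j) (hS : (1 - I.B * I.B) * S = 1)
    (hSb0 : ∀ i j, 0 ≤ Sb i j) (hSb : (1 - I.Bb * I.Bb) * Sb = 1) (l : List Piece)
    (hF : ∀ j, Summable (F (j + 1)) ∧ ∑' x, F (j + 1) x ≤ totalSlice I l j) :
    NSumLE F (c + total Reading.series I l) :=
  NSumLE_cons hc (NSumLE_of_sliceBounds (G := fun j x => F (j + 1) x) (fun j x => h0 (j + 1) x) hI hS0 hS hSb0 hSb l hF)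

/-- **The weighted `Ξ`-rows of Assumption 4.3 from per-`N` bounds** (plain, `ι`-`0` and `ι`-`e_ι` alike): explicit
cells `Σ_x Ξʷ_N ≤ c_N` for `N = 0, 1, 2, 3` (`Bound[·,N,Delta,·]`, cells 43–44) and per-`N` bounds for `N ≥ 4` by the
slices of the EVEN table `lE` (`N = 2j+4`) and of the ODD table `lO` (`N = 2j+5`) give the four `NSumLE` rows
`EvenTail-Δ ≤ c₂ + lE`, `OddTail-Δ ≤ c₃ + lO`, `Even-Δ ≤ c₀ + (c₂ + lE)`, `Odd-Δ ≤ c₁ + (c₃ + lO)` — cell 42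
"`Bound[Xi,Even,Delta,s] = Bound[Xi,0,Delta,s] + Bound[Xi,EvenTail,Delta,s]`" etc.; the `abs` row is `Odd + Even`
(`NobleKSpaceRewritePhi.NSumLE_of_even_odd`, not imported here).
[cite: FitznerVanDerHofstad2017, notebook Percolation.nb cells 42–44 (transcript l.1161–1237); Prop. 5.5 (5.35)–(5.36), Prop. 5.6 (5.38)–(5.41) (arXiv:1506.07977v2 p. 53); FitznerVanDerHofstad2016NoBLE Assumption 4.3 (4.32)–(4.33) (p. 1086)] -/
theorem NSumLE_weightedRows_of_sliceBounds {Ξ : ℕ → Site d → ℝ} (h0 : ∀ N x, 0 ≤ Ξ N x) {c₀ c₁ c₂ c₃ : ℝ}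
    (hc₀ : SumLE (Ξ 0) c₀) (hc₁ : SumLE (Ξ 1) c₁) (hc₂ : SumLE (Ξ 2) c₂) (hc₃ : SumLE (Ξ 3) c₃)
    {I : Ingr n} (hI : I.Nonneg) {S Sb : Matrix n n ℝ} (hS0 : ∀ i j, 0 ≤ S i j) (hS : (1 - I.B * I.B) * S = 1)
    (hSb0 : ∀ i j, 0 ≤ Sb i j) (hSb : (1 - I.Bb * I.Bb) * Sb = 1) (lE lO : List Piece)
    (hE : ∀ j, Summable (Ξ (2 * j + 4)) ∧ ∑' x, Ξ (2 * j + 4) x ≤ totalSlice I lE j)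
    (hO : ∀ j, Summable (Ξ (2 * j + 5)) ∧ ∑' x, Ξ (2 * j + 5) x ≤ totalSlice I lO j) :
    NSumLE (fun k x => Ξ (2 * k + 2) x) (c₂ + total Reading.series I lE)
      ∧ NSumLE (fun k x => Ξ (2 * k + 3) x) (c₃ + total Reading.series I lO)
      ∧ NSumLE (fun k x => Ξ (2 * k) x) (c₀ + (c₂ + total Reading.series I lE))
      ∧ NSumLE (fun k x => Ξ (2 * k + 1) x) (c₁ + (c₃ + total Reading.series I lO)) := by
  have hET : NSumLE (fun k x => Ξ (2 * k + 2) x) (c₂ + total Reading.series I lE) :=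
    NSumLE_tail_of_sliceBounds (F := fun k x => Ξ (2 * k + 2) x) (fun k x => h0 _ x) hc₂ hI hS0 hS hSb0 hSb lE
      (fun j => hE j)
  have hOT : NSumLE (fun k x => Ξ (2 * k + 3) x) (c₃ + total Reading.series I lO) :=
    NSumLE_tail_of_sliceBounds (F := fun k x => Ξ (2 * k + 3) x) (fun k x => h0 _ x) hc₃ hI hS0 hS hSb0 hSb lO
      (fun j => hO j)
  exact ⟨hET, hOT, NSumLE_cons (F := fun k x => Ξ (2 * k) x) hc₀ hET,
    NSumLE_cons (F := fun k x => Ξ (2 * k + 1) x) hc₁ hOT⟩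

end Glue

end Literature.Probability.FitznerVanDerHofstad2017.NobleNSums

end
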